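import Literature.AlgebraicGeometry.ProjectiveSpace.CayleyBacharachPointSets
import HarnessLib

/-!
# Bézout's bound for point counts: `r` forms of degrees `d_1, …, d_r` in `ℙ^r` forming a regular
# sequence have at most `∏ d_i` distinct common zeros (EGH 1996 §1.1; Hartshorne I Thm. 7.7)

Topic `Literature/AlgebraicGeometry/ProjectiveSpace`, namespace
`Literature.AlgebraicGeometry.ProjectiveSpace`. Lane `lit-hodgefound`, seat `lit-hodgefound-p32`,
row gen25-#12. Theorems only (no definition, no named fact).

## The sources, as printed

D. Eisenbud, M. Green, J. Harris, *Cayley–Bacharach theorems and conjectures*, Bull. AMS 33 (1996),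
§1.1 (p. 299): "All we shall need is the classical theorem of Bézout: Plane curves of degrees `d` and
`e` cannot meet in more than `d · e` points unless they have a component in common (that is, unless the
equations defining them have a common factor)." R. Hartshorne, *Algebraic Geometry*, I Thm. 7.7
(p. 53): for a variety `Y ⊆ ℙⁿ` of dimension `≥ 1` and a hypersurface `H ⊉ Y`,
`Σ_j i(Y, H; Z_j) · deg Z_j = (deg Y)(deg H)` — iterated over `r` hypersurfaces of `ℙ^r` meeting
properly, the number of common points is at most `∏ deg H_i`.

## The proof formalised

With `I = (f_1, …, f_r)` (`[f_1, …, f_r]` a regular sequence of forms of positive degrees `d_i` in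
`S = k[x_0, …, x_r]`, `k` infinite) and `Γ = {p_j}` distinct common zeros: `I ⊆ I(Γ)`, so
`H_Γ(n) ≤ H_{S/I}(n)` for all `n`; a linear form `L` regular modulo `I` exists
(`LaurentCech.exists_linearForm_regular_pair`), `J = I + (L)` is an Artinian complete intersection
with `Σ_t H_{S/J}(t) = ∏ d_i` (`CayleyBacharachPointSets.isArtinianGorenstein_span_sup_span_linearForm`)
and `H_{S/I}(n) = Σ_{t ≤ n} H_{S/J}(t)` (`sum_range_hilbert_sup_span_eq`), so `H_{S/I}(n) = ∏ d_i` for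
`n ≥ Σ d_i − r`; finally `H_Γ(n) = #Γ` for `n ≥ #Γ − 1` (`PointsVanishingIdeal`).

## What is here (all `theorem`s)

* `hilbert_span_eq_prod_of_le` — `H_{S/(f)}(n) = ∏ d_i` for all `n ≥ Σ d_i − r`.
* **`card_le_prod_of_forall_eval_eq_zero`** — `#Γ ≤ ∏ d_i` for distinct common zeros `Γ` of a regular
  sequence of `r` forms in `ℙ^r`.
* **`card_le_mul_of_planeCurves`** — EGH's statement: plane curves of degrees `d, e` without common
  component meet in at most `d · e` distinct points.

## References

* [EisenbudGreenHarris1996] D. Eisenbud, M. Green, J. Harris, *Cayley–Bacharach theorems and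
  conjectures*, Bull. Amer. Math. Soc. 33 (1996), §1.1 (p. 299).
* [Hartshorne1977] R. Hartshorne, *Algebraic Geometry*, GTM 52, Springer 1977, I Thm. 7.7 (p. 53).
-/

noncomputable section

open MvPolynomial Module RingTheory.Sequence
open Literature.RingTheory.MvPolynomial Literature.AlgebraicGeometry.DuqueFrancoVillaflor2025

universe u

namespace Literature.AlgebraicGeometry.ProjectiveSpace

variable {k : Type u} [Field k] {r : ℕ}

omit [Field k] in
/-- `(f_1, …, f_n) = Ideal.ofList [f_1, …, f_n]`. [folklore] -/
private theorem span_range_eq_ofList_aux {R : Type*} [CommSemiring R] {n : ℕ} (f : Fin n → R) :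
    Ideal.span (Set.range f) = Ideal.ofList (List.ofFn f) := by
  change Ideal.span (Set.range f) = Ideal.span {x | x ∈ List.ofFn f}
  congr 1
  ext x
  simp [List.mem_ofFn']

/-- **The Hilbert function of a one-dimensional complete intersection stabilises at `∏ d_i`**: for a
regular sequence of forms `f_1, …, f_r` of positive degrees `d_i` in `k[x_0, …, x_r]` (`k` infinite,
`r ≥ 1`), `H_{S/(f)}(n) = dim S_n − dim (f)_n = ∏ d_i` for every `n ≥ Σ d_i − r` (cut by a linear form
regular modulo `(f)`: the Artinian reduction has `Σ_t H(t) = ∏ d_i` and vanishes above the socle degree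
`Σ d_i − r`). [cite: Hartshorne1977, I Thm. 7.7 (p. 53)] [cite: EisenbudGreenHarris1996, §1.1 (p. 299)] -/
theorem hilbert_span_eq_prod_of_le [Infinite k] (hr : 1 ≤ r) (f : Fin r → MvPolynomial (Fin (r + 1)) k)
    (d : Fin r → ℕ) (hf : ∀ m, (f m).IsHomogeneous (d m)) (hd : ∀ m, 0 < d m)
    (hreg : IsWeaklyRegular (MvPolynomial (Fin (r + 1)) k) (List.ofFn f)) {n : ℕ}
    (hn : ∑ m, d m ≤ n + r) :
    finrank k (homogeneousSubmodule (Fin (r + 1)) k n) -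
      finrank k (idealDegree (Ideal.span (Set.range f)) n) = ∏ m, d m := by
  classical
  set I := Ideal.span (Set.range f) with hIdef
  have hIhom' : ∀ g ∈ I, ∀ n : ℕ, homogeneousComponent n g ∈ I := by
    letI := MvPolynomial.gradedAlgebra (σ := Fin (r + 1)) (R := k)
    have hIhom : I.IsHomogeneous (homogeneousSubmodule (Fin (r + 1)) k) :=
      Ideal.homogeneous_span _ _ (by rintro _ ⟨m, rfl⟩; exact ⟨d m, hf m⟩)
    exact fun g hg n => homogeneousComponent_mem_of_mem hIhom hg n
  -- a linear form regular modulo `(f)` (prime avoidance in the Čech dictionary)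
  have hhomlist : ∀ g ∈ List.ofFn f, ∃ c : ℕ, g.IsHomogeneous c := by
    intro g hg
    obtain ⟨m, rfl⟩ := (List.mem_ofFn' f g).mp hg
    exact ⟨d m, hf m⟩
  have hregU : IsWeaklyRegular (Unit → MvPolynomial (Fin (r + 1)) k) (List.ofFn f) :=
    ((LinearEquiv.funUnique Unit (MvPolynomial (Fin (r + 1)) k)
      (MvPolynomial (Fin (r + 1)) k)).isWeaklyRegular_congr (List.ofFn f)).mpr hreg
  have hsat : Literature.Algebra.Homology.LaurentCech.sat
      (Ideal.ofList (List.ofFn f) • (⊤ : Submodule (MvPolynomial (Fin (r + 1)) k)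
        (Unit → MvPolynomial (Fin (r + 1)) k))) = Ideal.ofList (List.ofFn f) • ⊤ :=
    Literature.Algebra.Homology.LaurentCech.sat_ofList_smul_top_eq hr (List.ofFn f) hhomlist hregU
      (by rw [List.length_ofFn])
  obtain ⟨L, hL0, hL1, -, hLI, -⟩ :=
    Literature.Algebra.Homology.LaurentCech.exists_linearForm_regular_pair
      (Ideal.ofList (List.ofFn f) • (⊤ : Submodule (MvPolynomial (Fin (r + 1)) k)
        (Unit → MvPolynomial (Fin (r + 1)) k)))
      (Ideal.ofList (List.ofFn f) • (⊤ : Submodule (MvPolynomial (Fin (r + 1)) k)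
        (Unit → MvPolynomial (Fin (r + 1)) k)))
      (fun v hv => Literature.Algebra.Homology.LaurentCech.mem_of_forall_X_smul_mem_of_sat_le hsat.le v hv)
      (fun v hv => Literature.Algebra.Homology.LaurentCech.mem_of_forall_X_smul_mem_of_sat_le hsat.le v hv)
  have hLI' : ∀ g, L * g ∈ I → g ∈ I := by
    intro g hg
    have h1 := hLI (fun _ => g) (by
      rw [mem_ideal_smul_top_iff, Pi.smul_apply, smul_eq_mul, ← span_range_eq_ofList_aux]; exact hg)
    rwa [mem_ideal_smul_top_iff, ← span_range_eq_ofList_aux] at h1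
  -- the Artinian reduction `J = (f) + (L)`, socle degree `m = Σ d_i - r`
  obtain ⟨m, hm⟩ : ∃ m : ℕ, m + r = ∑ i, d i := by
    have hle : r ≤ ∑ i : Fin r, d i := by
      calc r = ∑ _i : Fin r, 1 := by simp
        _ ≤ ∑ i : Fin r, d i := Finset.sum_le_sum fun i _ => hd i
    exact ⟨∑ i, d i - r, by omega⟩
  obtain ⟨hAG, hsum⟩ := isArtinianGorenstein_span_sup_span_linearForm f d hf hd hreg hL1 hLI' hm
  set J := I ⊔ Ideal.span {L} with hJdef
  have htel := sum_range_hilbert_sup_span_eq hIhom' hL0 hL1 hLI'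
  have hzero : ∀ t, m < t →
      finrank k (homogeneousSubmodule (Fin (r + 1)) k t) - finrank k (idealDegree J t) = 0 := by
    intro t ht
    rw [hAG.idealDegree_eq_of_lt ht, Nat.sub_self]
  -- `H_{S/I}(n) = ∏ d_i` for `n ≥ m`
  have hstab : ∀ n, m ≤ n → finrank k (homogeneousSubmodule (Fin (r + 1)) k n) -
      finrank k (idealDegree I n) = ∏ i, d i := by
    intro n hn
    induction n, hn using Nat.le_induction with
    | base => rw [← htel, hsum]
    | succ n hn ih =>
      have h := htel (n + 1)
      rw [Finset.sum_range_succ, htel n, ih, hzero (n + 1) (by omega), add_zero] at h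
      exact h.symm
  exact hstab n (by omega)

/-- **Bézout's bound: `r` forms in `ℙ^r_k` forming a regular sequence have at most `∏ d_i` distinct
common zeros** (`k` infinite, `r ≥ 1`; the `p_j` non-zero, pairwise non-proportional common zeros of
`f_1, …, f_r`, forms of positive degrees `d_i` with `[f_1, …, f_r]` weakly regular): `#ι ≤ ∏ d_i`, since
`#ι = H_Γ(n) ≤ H_{S/(f)}(n) = ∏ d_i` for `n` large. [cite: Hartshorne1977, I Thm. 7.7 (p. 53)]
[cite: EisenbudGreenHarris1996, §1.1 (p. 299)] -/
theorem card_le_prod_of_forall_eval_eq_zero [Infinite k] {ι : Type*} [Fintype ι] (hr : 1 ≤ r)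
    (f : Fin r → MvPolynomial (Fin (r + 1)) k) (d : Fin r → ℕ) (hf : ∀ m, (f m).IsHomogeneous (d m))
    (hd : ∀ m, 0 < d m) (hreg : IsWeaklyRegular (MvPolynomial (Fin (r + 1)) k) (List.ofFn f))
    (p : ι → Fin (r + 1) → k) (h0 : ∀ i, p i ≠ 0)
    (hp : Pairwise fun i j => p i ∉ (k ∙ p j : Submodule k (Fin (r + 1) → k)))
    (hZ : ∀ i m, MvPolynomial.eval (p i) (f m) = 0) : Fintype.card ι ≤ ∏ m, d m := by
  classical
  have hIle : Ideal.span (Set.range f) ≤ projVanishingIdeal (Set.range p) := by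
    rw [Ideal.span_le]
    rintro _ ⟨m, rfl⟩
    exact mem_projVanishingIdeal_of_isHomogeneous (hf m) (by rintro _ ⟨i, rfl⟩; exact hZ i m)
  set N := max (∑ m, d m) (Fintype.card ι) with hNdef
  have h1 := hilbert_projVanishingIdeal_eq_card p h0 hp (n := N) (by omega)
  have h2 := hilbert_antitone hIle N
  have h3 := hilbert_span_eq_prod_of_le hr f d hf hd hreg (n := N) (by omega)
  omega

/-- **Bézout for plane curves, point-count form: "plane curves of degrees `d` and `e` cannot meet in
more than `d · e` points unless they have a component in common"** (`[F, G]` a regular sequence; the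
common zeros taken as non-zero pairwise non-proportional vectors; `k` infinite).
[cite: EisenbudGreenHarris1996, §1.1 (p. 299)] -/
theorem card_le_mul_of_planeCurves [Infinite k] {ι : Type*} [Fintype ι] (F G : MvPolynomial (Fin 3) k)
    {d e : ℕ} (hF : F.IsHomogeneous d) (hG : G.IsHomogeneous e) (hd : 0 < d) (he : 0 < e)
    (hreg : IsWeaklyRegular (MvPolynomial (Fin 3) k) [F, G]) (p : ι → Fin 3 → k) (h0 : ∀ i, p i ≠ 0)
    (hp : Pairwise fun i j => p i ∉ (k ∙ p j : Submodule k (Fin 3 → k)))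
    (hZF : ∀ i, MvPolynomial.eval (p i) F = 0) (hZG : ∀ i, MvPolynomial.eval (p i) G = 0) :
    Fintype.card ι ≤ d * e := by
  have h := card_le_prod_of_forall_eval_eq_zero (r := 2) (by norm_num) ![F, G] ![d, e]
    (fun m => ?_) (fun m => ?_) (by simpa using hreg) p h0 hp (fun i m => ?_)
  · rwa [Fin.prod_univ_two] at h
  · fin_cases m
    · exact hF
    · exact hG
  · fin_cases m
    · exact hd
    · exact he
  · fin_cases m
    · exact hZF i
    · exact hZG i

end Literature.AlgebraicGeometry.ProjectiveSpace

end
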